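import Summits.QuantumFields.BalabanUV.T4Continuum.Support.B13StepEnvelopeEndSub

/-!
# NE5 ∕ U3 — THE η-UNIFORM CAUCHY END FACES: E9 (model level, any operator carrier) ∕ E9[rec] ∕ E9[rec,sub] with `∃ C₅` OUTERMOST —
# ONE constant from the SIZES for every carriers, operator carrier, assembled model, pair of runs, slot package, sub-slot, window,
# roomy class and activity dictionary (part 1 of 2; part 2 `B13StepEnvelopeEndWindow` = the carrier of record `↥measOp` + the
# reassembly from singleton windows, owner RULINGS R24 × R29′)

Cell `pub-balaban`, unit `b2b-balaban-t4-ne5-formalise-leaf-03` (NE5 formalisation swarm, LEAF PROVER 03, gen 7; follower of this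
lineage's Cauchy line `Support/B13StepEnvelopeEnd.lean` p214842 (E9 ∕ E9[rec]), `Support/B13StepEnvelopeEndArithmetic.lean` p214993
(letters eliminated) and `Support/B13StepEnvelopeEndSub.lean` p216841 (R20 re-point), in the pattern of leaf-10's
`B13StepEndArithmetic.uniform_ne5_of_record` (N69, E1) and `B13StepSecantArithmetic.uniform_ne5_of_record_secant` (N80, E8); journal
INTENT `CLAIMS.log` l.12800, CLAIM RULE 1).  Summits-side NEW WORK under the LEAN PLACEMENT RULE (cell bookkeeping; NOT a Literature
module; 0 `def`, 0 cite tag); nothing landed is edited — three landed faces are applied BY NAME.  HONEST FRAMING: rung (B)+1 of the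
FINITE-VOLUME T⁴ continuum programme — NOT infinite volume, NOT a mass gap, NOT the Clay problem, and **NOT A PROOF OF NE5** (NOT
PRINTED in [Balaban1987RG1]–[Balaban1989LargeFieldII], which print ε-UNIFORM bounds, never η-RATES; cell GAPS G-t4-U3-1): every
theorem below is an IMPLICATION whose wall binders — W2-op = `ActOpLineAnalyticOn` at FACTOR level (GAPS G-ne5p1-1′∕1″, NOT PRINTED,
RELOCATED; over a sub-slot of measurable data satisfiable in principle after R20, NOT discharged), the per-activity norm majorant ((2.38)
KIND) with its per-domain budget or its decay split + anchored norm ((1.26) KIND), W1 (margin units or row NE2's entry currency), W4,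
the one-run slice budgets (W3 KIND), the quoted one-run levels L05∕L06 ([Balaban1987RG1] (1.18) p. 263 — SHAPE only), the radii — are
DISPLAYED HYPOTHESES, asserted nowhere (c3∕c4∕c6).  HONEST DEPENDENCY (cell line, verbatim): continuum YM on T⁴ ⇐ BetaPertH ∧ nine
spine estimates (0/9 proved); BetaPertH ⇐ (D1) ∧ (D4) ∧ CAP+tail; G-an2-4 gates asym, D1 and NE2/3/4.

THE POINT (quantifier order; decls, not adjectives).  Every letters-eliminated Cauchy face landed so far —
`B13StepEnvelopeEndArithmetic.exists_ne5_of_record_envelope_*` (p214993), `B13StepEnvelopeEndSub.exists_ne5_of_record_restrict_envelope_*`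
(p216841), `B13StepEnvelopeEndMeasOp.exists_ne5_of_record_measOp_envelope_readAt` (p217285) — reads `⟨binders at W⟩ → ∃ C₅, NE5 … W … C₅`:
the constant is produced AFTER the pair of runs, the slot package and the window are bound.  Such a face applied per singleton window
`{g}` gives `∀ g ∈ W, ∃ C₅(g), …` only — NOT `NE5` on `W` (owner's negative control `OutputRateWindowBounded.grow_not_exists_uniform`;
R29: TERMINAL for its window).  But the constant of the Cauchy END,
`C₅ = (G∕(1−ρ₀)·δ + G∕(1−ρ₀)·δ′ + B)(θ′ − ω)∕(θ′ − (ω + G∕(1−ρ₀)·cA))` with `ρ₀, k₀, B` chosen from the sizes by leaf-10's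
`B13StepEndArithmetic.reach_elim_iff` ∕ `OutputRateArithmetic.reach_binders_exists` (sharp), depends on the SIZE LETTERS ONLY.  So the
faces below read `∃ C₅, ∀ (carriers) (operator carrier) (model ∕ pair of runs, slot package, sub-slot) (window) (roomy class)
(dictionaries), ω-of-the-model = ω → ⟨binders at W⟩ → NE5 … W … C₅` — and R24's recipe («instantiate per singleton window with g-indexed
dictionaries, then reassemble», `OutputRateWindow.ne5_of_forall_singleton`) runs through the Cauchy END at NO cost in the constant
(part 2), exactly as it does through E1 (N69, `B13StepEndArithmeticWindow` p217294 §2) and E8 (N80, p217294 §4).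

WHAT THIS FILE PROVES (kernel; `[folklore]`; no definition):
* §1 MODEL LEVEL, ANY CARRIERS, ANY OPERATOR CARRIER — **`uniform_ne5_of_assemblyOn_envelope_opRate`**: ONE `C₅` from the sizes
  `κ, G, EA₀, E₀, cA, cB, δ, δ′, 0 < θ < 1, θ ≤ θ′ ≤ 1, 0 < ω < 1` under the two strict size inequalities `cA(EA₀ + E₀) < 1 − ω`,
  `ω + G·cA·(1 − ω)∕(1 − ω − cA(EA₀ + E₀)) < θ′`, for EVERY `C : Carriers`, every complex normed `Op`, every `𝔄 : AssemblyOn C Op …` with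
  `𝔄.D.ω = ω`, window, roomy class, norm majorant `A` (per-domain budget `G`) and exp-linear datum `Dt` — the binders of
  `B13StepEnvelopeEndSub.ne5_of_assemblyOn_envelope_opRate` (W1 in margin units `OperatorRate δ θ`); **`uniform_ne5_of_assemblyOn_envelope_reading`**
  — the same with W1 PRODUCED along a norm-non-contracting reading `rd : Op →L[ℂ] OpDatum E` from row NE2's entry currency (`δ := c₁∕r₀`).
* §2 CARRIERS OF RECORD — **`uniform_ne5_of_record_envelope`**: E9[rec] (`B13StepEnvelopeEnd.ne5_of_record_envelope_actNormDecay`, per-domain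
  budget from the decay split + anchored norm `Φ′`, `G := Φ′∕(1 − 36Φ′)`): ONE `C₅` for every pair of runs `R : TwoRuns 𝔾` (every pair
  of lattice spacings), slot package `S` (`S.D.ω = ω`), window, roomy class, majorants `A`∕`A′`, datum `Dt`.
* §3 R20's RE-POINT — **`uniform_ne5_of_record_restrict_envelope`**: E9[rec,sub] (`B13StepEnvelopeEndSub.ne5_of_record_restrict_envelope_actNormDecay`):
  the same for every sub-slot `M ≤ OpDatum E` containing the data of record, operator-ball binders over `↥M`, root
  `NE5 (B13StepOfRecord.outA S₀ E₀ cB) (B13StepOfRecord.outB S₀ E₀ cB) W κ θ′ C₅`.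
NOT claimed: any estimate; any value of a letter; that Bałaban's step satisfies a binder.  The g- and η-uniformity of the SIZES is what
[Balaban1988RG2Cluster] asserts of its O(1) constants («uniform in k and in the couplings», p. 21 — KIND), DISPLAYED here as the
hypothesis that one tuple of letters serves every pair of runs and every `g ∈ W`, not asserted.  0 sorry; axioms ⊆ {propext,
Classical.choice, Quot.sound}.
-/

noncomputable section

open scoped BigOperators
open Metric Set

namespace Summit.QuantumFields.BalabanUV.T4Continuum.B13StepEnvelopeEndUniform

open Literature.MathematicalPhysics.QuantumFieldTheory.Balaban1983to89
open Literature.MathematicalPhysics.QuantumFieldTheory.Balaban1983to89.T4OutputRate (Carriers Functional DecayBound NE5)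
open Literature.MathematicalPhysics.QuantumFieldTheory.Balaban1983to89.T4InputCauchyRateSpecies (ballClass)
open Summit.QuantumFields.BalabanUV.T4Continuum.B13Carriers (TwoRuns)
open Summit.QuantumFields.BalabanUV.T4Continuum.B13OpDatum (Format OpDatum)
open Summit.QuantumFields.BalabanUV.T4Continuum.B13OpDatumJunctions (opOf RawBounded WeightedEntrywiseRate)
open Summit.QuantumFields.BalabanUV.T4Continuum.B13StepTermLabels (TermIdx InnerLabel)
open Summit.QuantumFields.BalabanUV.T4Continuum.B13StepTermFamily (ActData ActExpLinearOn)
open Summit.QuantumFields.BalabanUV.T4Continuum.B13StepTermSocket (labelsIndexing touchInc)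
open Summit.QuantumFields.BalabanUV.T4Continuum.B13InnerData (Bnd b13InnerData)
open Summit.QuantumFields.BalabanUV.T4Continuum.B13TermRep (actMajorant)
open Summit.QuantumFields.BalabanUV.T4Continuum.UrsellTreeSum (ind)
open Summit.QuantumFields.BalabanUV.T4Continuum.UrsellTermBudget (actSum)
open Summit.QuantumFields.BalabanUV.T4Continuum.B13Base (selfCtr)
open Summit.QuantumFields.BalabanUV.T4Continuum.B13DomainGeometryTR (SCube footprint domainGeometry)
open Summit.QuantumFields.BalabanUV.T4Continuum.B13RepresentsOn (AssemblyOn)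
open Summit.QuantumFields.BalabanUV.T4Continuum.B13StepOfRecord (Slots assembly step outA outB)
open Summit.QuantumFields.BalabanUV.T4Continuum.B13StepOfRecordSub (assemblyOn restrict)
open Summit.QuantumFields.BalabanUV.T4Continuum.B13TermOpEnvelope (ActOpLineAnalyticOn)
open Summit.QuantumFields.BalabanUV.T4Continuum.B13StepEndArithmetic (reach_elim_iff smallness_of_gain)
open Summit.QuantumFields.BalabanUV.T4Continuum.OutputRateArithmetic (reach_binders_exists)
open Summit.QuantumFields.BalabanUV.T4Continuum.B13StepEnvelopeEnd (ne5_of_record_envelope_actNormDecay)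
open Summit.QuantumFields.BalabanUV.T4Continuum.B13StepEnvelopeEndSub
  (ne5_of_assemblyOn_envelope_opRate ne5_of_assemblyOn_envelope_reading ne5_of_record_restrict_envelope_actNormDecay)

/-! ## §1 Model level: one constant for every carriers, operator carrier, assembly, window, roomy class and dictionary -/

section Model

/-- [folklore] **THE η-UNIFORM CAUCHY END FACE AT MODEL LEVEL, W1 IN MARGIN UNITS.**  Fix the displayed SIZES — decay rate `κ`,
per-domain activity budget `G`, one-run levels `EA₀, E₀`, slice constants `cA, cB`, W1's margin-unit rate constant `δ`, W4's `δ′`, the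
input rate `0 < θ < 1`, the target rate `θ ≤ θ′ ≤ 1`, the age damping `0 < ω < 1` — subject to the two strict size inequalities
`cA(EA₀ + E₀) < 1 − ω` and `ω + G·cA·(1 − ω)∕(1 − ω − cA(EA₀ + E₀)) < θ′` (leaf-10's `reach_elim_iff` ∕ `reach_binders_exists` ∕
`smallness_of_gain`: the letters `ρ₀, k₀, B` of `B13StepEnvelopeEndSub.ne5_of_assemblyOn_envelope_opRate` ELIMINATED, sharply, `E₁ := 1`).
Then ONE constant `C₅` serves EVERY carriers `C`, every complex normed operator carrier `Op`, every assembled model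
`𝔄 : AssemblyOn C Op IOp Hist ι P J` with `𝔄.D.ω = ω`, every window `W`, roomy class `ROp, RHist`, per-activity norm majorant `A` and
exp-linear datum `Dt`: the displayed binders of that face — the transport reading; the two one-run slice budgets; the quoted levels
`DecayBound (𝔄.outA …) W EA₀ κ` ∕ `DecayBound (𝔄.outB …) W E₀ κ`; W1 `OperatorRate W δ θ`; W4 `InsertionRate W κ E₀ δ′ θ`; room ×2;
`A` dominating the (2.14)-activities on the ball class with per-domain budget `Summable ∧ Σ' ≤ G·e^{−κd}`; **`ActOpLineAnalyticOn`** (W2-op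
at factor level — GAPS G-ne5p1-1′∕1″, NOT PRINTED) and `ActExpLinearOn` (W2-hist STRUCTURE) — IMPLY
`NE5 (𝔄.outA (𝔄.bHist E₀ cB)) (𝔄.outB (𝔄.bHist E₀ cB)) W κ θ′ C₅`.  The uniformity is the quantifier order `∃ C₅, ∀ C Op 𝔄 W …`.
NOT a proof of NE5: an implication from displayed binders. -/
theorem uniform_ne5_of_assemblyOn_envelope_opRate {κ G EA₀ E₀ cA cB δ δ' θ θ' ω : ℝ}
    (hE₀ : 0 ≤ E₀) (hG : 0 ≤ G) (hcA : 0 ≤ cA) (hcB : 0 ≤ cB) (hδ : 0 ≤ δ) (hδ' : 0 ≤ δ')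
    (hθ0 : 0 < θ) (hθ1 : θ < 1) (hθθ' : θ ≤ θ') (hθ'1 : θ' ≤ 1) (hω : 0 < ω) (hω1 : ω < 1)
    (hh : cA * (EA₀ + E₀) < 1 - ω) (hsmall : ω + G * cA * (1 - ω) / (1 - ω - cA * (EA₀ + E₀)) < θ') :
    ∃ C₅ : ℝ, ∀ {C : Carriers} {Op IOp Hist ι P J Ω : Type*} [NormedAddCommGroup Op] [NormedSpace ℂ Op]
      [NormedAddCommGroup Hist] [NormedSpace ℂ Hist] [MeasurableSpace Ω] (𝔄 : AssemblyOn C Op IOp Hist ι P J)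
      {W : Set (ℕ → ℝ)} {ROp RHist : ℕ → ℝ} {A : ℕ → (ℕ → ℝ) → C.BgB → P → J → ℝ} {Dt : ActData P J Op Hist Ω},
      𝔄.D.ω = ω →
      𝔄.TransportReads W →
      𝔄.SliceBudgetB W κ cB → 𝔄.D.SliceBudget (𝔄.stepOn (𝔄.bHist E₀ cB)) W κ cA →
      DecayBound (𝔄.outA (𝔄.bHist E₀ cB)) W EA₀ κ → DecayBound (𝔄.outB (𝔄.bHist E₀ cB)) W E₀ κ →
      (𝔄.stepOn (𝔄.bHist E₀ cB)).OperatorRate W δ θ → (𝔄.stepOn (𝔄.bHist E₀ cB)).InsertionRate W κ E₀ δ' θ →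
      (∀ k, 𝔄.rOp k ≤ ROp k) → (∀ k, 𝔄.bHist E₀ cB k + 𝔄.rHist k ≤ RHist k) →
      (∀ k, ∀ g ∈ W, ∀ (U : C.BgB) (q : Op × Hist), q ∈ ballClass (selfCtr 𝔄.raw 𝔄.histRef) ROp RHist k g U →
        ∀ X : C.Dom, C.scale X = k → ∀ i, 𝔄.𝒯.Rel k i X → ∀ m,
          ‖𝔄.act (𝔄.𝒯.poly i m) (𝔄.𝒯.lab i m) q.1 q.2‖ ≤ A k g U (𝔄.𝒯.poly i m) (𝔄.𝒯.lab i m)) →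
      (∀ k, ∀ g ∈ W, ∀ (U : C.BgB) (X : C.Dom), C.scale X = k →
        Summable (actMajorant 𝔄.𝒯 𝔄.inc (A k g U) k X) ∧
          ∑' i, actMajorant 𝔄.𝒯 𝔄.inc (A k g U) k X i ≤ G * Real.exp (-(κ * C.d X))) →
      ActOpLineAnalyticOn 𝔄.𝒯 𝔄.act (ballClass (selfCtr 𝔄.raw 𝔄.histRef) ROp RHist) W →
      ActExpLinearOn 𝔄.𝒯 𝔄.act Dt (ballClass (selfCtr 𝔄.raw 𝔄.histRef) ROp RHist) W →
      NE5 (𝔄.outA (𝔄.bHist E₀ cB)) (𝔄.outB (𝔄.bHist E₀ cB)) W κ θ' C₅ := by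
  obtain ⟨ρ₀, hreach, hρ₀, hs⟩ := (reach_elim_iff (mul_nonneg hG hcA) hω1).mpr ⟨hh, hsmall⟩
  obtain ⟨k₀, B, hB, hnear, hfirst⟩ := reach_binders_exists (D := δ + δ') (add_nonneg hδ hδ') hθ0 hθ1 hreach
  refine ⟨(G / (1 - ρ₀) * δ + G / (1 - ρ₀) * δ' + B) * (θ' - ω) / (θ' - (ω + G / (1 - ρ₀) * cA)), ?_⟩
  intro C Op IOp Hist ι P J Ω _ _ _ _ _ 𝔄 W ROp RHist A Dt h𝔄ω hT hbB hbA hdA hdB hop hins hOp hHist hA hbud hact hexp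
  subst h𝔄ω
  exact ne5_of_assemblyOn_envelope_opRate 𝔄 hT hbB hbA hdA hdB hop hins hOp hHist hA hbud hact hexp hE₀ one_pos hG hcA hcB hδ hδ'
    hθ0.le hθθ' hθ'1 hω hω1 hρ₀ hnear hB hfirst (smallness_of_gain hs)

/-- [folklore] **THE η-UNIFORM CAUCHY END FACE AT MODEL LEVEL, W1 ALONG A READING** (R20: «W1 readings transfer along `rd`»): §1's
first face with W1 PRODUCED from row NE2's DISPLAYED weighted entrywise two-run species rate `c₁·θ^k` (bounded raw suppliers, margin floor
`r₀`) along a norm-non-contracting reading `rd : Op →L[ℂ] OpDatum E` under which the operator data ARE `opOf F rawA`∕`opOf F rawB`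
(`B13StepEnvelopeEndSub.ne5_of_assemblyOn_envelope_reading`); sizes as in §1 with `c₁, r₀` in place of `δ` (`δ := c₁∕r₀`); ONE `C₅` for
every carriers, operator carrier, reading, formats ∕ raw species, assembly (`𝔄.D.ω = ω`), window, roomy class and dictionaries. -/
theorem uniform_ne5_of_assemblyOn_envelope_reading {κ G EA₀ E₀ cA cB c₁ r₀ δ' θ θ' ω : ℝ}
    (hE₀ : 0 ≤ E₀) (hG : 0 ≤ G) (hcA : 0 ≤ cA) (hcB : 0 ≤ cB) (hc₁ : 0 ≤ c₁) (hr₀ : 0 < r₀) (hδ' : 0 ≤ δ')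
    (hθ0 : 0 < θ) (hθ1 : θ < 1) (hθθ' : θ ≤ θ') (hθ'1 : θ' ≤ 1) (hω : 0 < ω) (hω1 : ω < 1)
    (hh : cA * (EA₀ + E₀) < 1 - ω) (hsmall : ω + G * cA * (1 - ω) / (1 - ω - cA * (EA₀ + E₀)) < θ') :
    ∃ C₅ : ℝ, ∀ {C : Carriers} {Op E IOp Hist ι P J Ω : Type*} [NormedAddCommGroup Op] [NormedSpace ℂ Op]
      [NormedAddCommGroup Hist] [NormedSpace ℂ Hist] [MeasurableSpace Ω] (𝔄 : AssemblyOn C Op IOp Hist ι P J)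
      (rd : Op →L[ℂ] OpDatum E) (_hrd : ∀ z : Op, ‖z‖ ≤ ‖rd z‖)
      {F : ℕ → Format E} {rawA : (ℕ → ℝ) → C.BgA → ℕ → E → ℂ} {rawB : (ℕ → ℝ) → C.BgB → ℕ → E → ℂ}
      (_hrdA : ∀ g V k, rd (𝔄.opA g V k) = opOf F rawA g V k) (_hrdB : ∀ g U k, rd (𝔄.opB g U k) = opOf F rawB g U k)
      {W : Set (ℕ → ℝ)} {ROp RHist : ℕ → ℝ} {A : ℕ → (ℕ → ℝ) → C.BgB → P → J → ℝ} {Dt : ActData P J Op Hist Ω},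
      𝔄.D.ω = ω →
      𝔄.TransportReads W →
      𝔄.SliceBudgetB W κ cB → 𝔄.D.SliceBudget (𝔄.stepOn (𝔄.bHist E₀ cB)) W κ cA →
      DecayBound (𝔄.outA (𝔄.bHist E₀ cB)) W EA₀ κ → DecayBound (𝔄.outB (𝔄.bHist E₀ cB)) W E₀ κ →
      RawBounded F (fun g U k => rawA g (C.transport U) k) W → RawBounded F rawB W →
      WeightedEntrywiseRate F (fun g U k => rawA g (C.transport U) k) rawB W c₁ (fun k => θ ^ k) → (∀ k, r₀ ≤ 𝔄.rOp k) →
      (𝔄.stepOn (𝔄.bHist E₀ cB)).InsertionRate W κ E₀ δ' θ →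
      (∀ k, 𝔄.rOp k ≤ ROp k) → (∀ k, 𝔄.bHist E₀ cB k + 𝔄.rHist k ≤ RHist k) →
      (∀ k, ∀ g ∈ W, ∀ (U : C.BgB) (q : Op × Hist), q ∈ ballClass (selfCtr 𝔄.raw 𝔄.histRef) ROp RHist k g U →
        ∀ X : C.Dom, C.scale X = k → ∀ i, 𝔄.𝒯.Rel k i X → ∀ m,
          ‖𝔄.act (𝔄.𝒯.poly i m) (𝔄.𝒯.lab i m) q.1 q.2‖ ≤ A k g U (𝔄.𝒯.poly i m) (𝔄.𝒯.lab i m)) →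
      (∀ k, ∀ g ∈ W, ∀ (U : C.BgB) (X : C.Dom), C.scale X = k →
        Summable (actMajorant 𝔄.𝒯 𝔄.inc (A k g U) k X) ∧
          ∑' i, actMajorant 𝔄.𝒯 𝔄.inc (A k g U) k X i ≤ G * Real.exp (-(κ * C.d X))) →
      ActOpLineAnalyticOn 𝔄.𝒯 𝔄.act (ballClass (selfCtr 𝔄.raw 𝔄.histRef) ROp RHist) W →
      ActExpLinearOn 𝔄.𝒯 𝔄.act Dt (ballClass (selfCtr 𝔄.raw 𝔄.histRef) ROp RHist) W →
      NE5 (𝔄.outA (𝔄.bHist E₀ cB)) (𝔄.outB (𝔄.bHist E₀ cB)) W κ θ' C₅ := by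
  obtain ⟨ρ₀, hreach, hρ₀, hs⟩ := (reach_elim_iff (mul_nonneg hG hcA) hω1).mpr ⟨hh, hsmall⟩
  obtain ⟨k₀, B, hB, hnear, hfirst⟩ :=
    reach_binders_exists (D := c₁ / r₀ + δ') (add_nonneg (div_nonneg hc₁ hr₀.le) hδ') hθ0 hθ1 hreach
  refine ⟨(G / (1 - ρ₀) * (c₁ / r₀) + G / (1 - ρ₀) * δ' + B) * (θ' - ω) / (θ' - (ω + G / (1 - ρ₀) * cA)), ?_⟩
  intro C Op E IOp Hist ι P J Ω _ _ _ _ _ 𝔄 rd hrd F rawA rawB hrdA hrdB W ROp RHist A Dt h𝔄ω hT hbB hbA hdA hdB hRA hRB hwer hfl hins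
    hOp hHist hA hbud hact hexp
  subst h𝔄ω
  exact ne5_of_assemblyOn_envelope_reading 𝔄 rd hrd hrdA hrdB hT hbB hbA hdA hdB hRA hRB hwer hfl hins hOp hHist hA hbud hact hexp hE₀
    one_pos hG hcA hcB hc₁ hr₀ hδ' hθ0.le hθθ' hθ'1 hω hω1 hρ₀ hnear hB hfirst (smallness_of_gain hs)

end Model

/-! ## §2 On Bałaban's paired-torus carriers OF RECORD: one constant for every pair of runs (E9[rec]) -/

section Record

/-- [folklore] **THE η-UNIFORM CAUCHY END FACE OF RECORD (E9[rec] with `∃ C₅` OUTERMOST).**  Fix the displayed SIZES — decay rate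
`κ ≥ 0`, the ANCHORED exponential norm level `Φ′` of the decay-split majorant (`0 ≤ Φ′`, `36Φ′ < 1`; the per-domain budget is then
`G := Φ′∕(1 − 36Φ′)` by leaf-01's `actBudget_record_of_actNormDecay` inside `B13StepEnvelopeEnd.ne5_of_record_envelope_actNormDecay`),
one-run levels `EA₀, E₀`, slice constants `cA, cB`, row NE2's entry constant `c₁` and margin floor `r₀`, W4's `δ′`, the input rate
`0 < θ < 1`, the target rate `θ ≤ θ′ ≤ 1`, the age damping `0 < ω < 1` — subject to the two strict size inequalities
`cA(EA₀ + E₀) < 1 − ω`, `ω + (Φ′∕(1 − 36Φ′))·cA·(1 − ω)∕(1 − ω − cA(EA₀ + E₀)) < θ′`.  Then ONE constant `C₅` serves EVERY pair of runs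
`R : B13Carriers.TwoRuns 𝔾` (every pair of lattice spacings), every slot package `S : B13StepOfRecord.Slots R E IOp Hist` with
`S.D.ω = ω`, every window `W`, roomy class `ROp, RHist`, majorants `A`∕`A′` and exp-linear datum `Dt`: the displayed binders of E9[rec]
— the transport reading; the two one-run slice budgets; `DecayBound (outA S E₀ cB) W EA₀ κ` ∕ `DecayBound (outB S E₀ cB) W E₀ κ`;
`RawBounded` ×2 + `WeightedEntrywiseRate … c₁ θ^k` + floor `r₀`; `InsertionRate W κ E₀ δ′ θ`; room ×2; the nonnegative per-activity norm
majorant `A` of `S.act` on the ball class with its decay split `A ≤ A′e^{−κ(d+5)}` (`A′ ≥ 0`) and the anchored norm of `A′` at most `Φ′`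
on every `R.domAt k`; **`ActOpLineAnalyticOn`** (W2-op at factor level) and `ActExpLinearOn` — IMPLY `NE5 (outA S E₀ cB) (outB S E₀ cB) W κ θ′ C₅`.
The η-uniformity of the constant is the quantifier order `∃ C₅, ∀ R S W …`.  NOT a proof of NE5: an implication from displayed binders. -/
theorem uniform_ne5_of_record_envelope {κ Φ' EA₀ E₀ cA cB c₁ r₀ δ' θ θ' ω : ℝ}
    (hE₀ : 0 ≤ E₀) (hκ : 0 ≤ κ) (hΦ0 : 0 ≤ Φ') (hΦsmall : 36 * Φ' < 1) (hcA : 0 ≤ cA) (hcB : 0 ≤ cB) (hc₁ : 0 ≤ c₁)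
    (hr₀ : 0 < r₀) (hδ' : 0 ≤ δ') (hθ0 : 0 < θ) (hθ1 : θ < 1) (hθθ' : θ ≤ θ') (hθ'1 : θ' ≤ 1) (hω : 0 < ω) (hω1 : ω < 1)
    (hh : cA * (EA₀ + E₀) < 1 - ω) (hsmall : ω + Φ' / (1 - 36 * Φ') * cA * (1 - ω) / (1 - ω - cA * (EA₀ + E₀)) < θ') :
    ∃ C₅ : ℝ, ∀ {𝔾 : Type} [GaugeGroup 𝔾] {R : TwoRuns 𝔾} {E IOp Hist Ω : Type*} [NormedAddCommGroup Hist] [NormedSpace ℂ Hist]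
      [MeasurableSpace Ω] (S : Slots R E IOp Hist) {W : Set (ℕ → ℝ)} {ROp RHist : ℕ → ℝ}
      {A A' : ℕ → (ℕ → ℝ) → R.carriers.BgB → R.carriers.Dom → InnerLabel R.carriers.Dom (Bnd R) → ℝ}
      {Dt : ActData R.carriers.Dom (InnerLabel R.carriers.Dom (Bnd R)) (OpDatum E) Hist Ω},
      S.D.ω = ω →
      (assembly S).TransportReads W →
      (assembly S).SliceBudgetB W κ cB → S.D.SliceBudget (step S E₀ cB) W κ cA →
      DecayBound (outA S E₀ cB) W EA₀ κ → DecayBound (outB S E₀ cB) W E₀ κ →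
      RawBounded S.F (assembly S).rawAt W → RawBounded S.F S.rawB W →
      WeightedEntrywiseRate S.F (assembly S).rawAt S.rawB W c₁ (fun k => θ ^ k) → (∀ k, r₀ ≤ S.rOp k) →
      (step S E₀ cB).InsertionRate W κ E₀ δ' θ →
      (∀ k, S.rOp k ≤ ROp k) → (∀ k, (assembly S).bHist E₀ cB k + S.rHist k ≤ RHist k) →
      (∀ k, ∀ g ∈ W, ∀ (U : R.carriers.BgB) (q : OpDatum E × Hist),
        q ∈ ballClass (selfCtr (assembly S).raw (assembly S).histRef) ROp RHist k g U → ∀ X : R.carriers.Dom,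
          R.carriers.scale X = k → ∀ i : TermIdx R.carriers.Dom (Bnd R), (labelsIndexing (domainGeometry R) (b13InnerData R)).Rel k i X →
            ∀ m, ‖S.act ((labelsIndexing (domainGeometry R) (b13InnerData R)).poly i m)
                ((labelsIndexing (domainGeometry R) (b13InnerData R)).lab i m) q.1 q.2‖ ≤
              A k g U ((labelsIndexing (domainGeometry R) (b13InnerData R)).poly i m)
                ((labelsIndexing (domainGeometry R) (b13InnerData R)).lab i m)) →
      (∀ k g U Z ℓ, 0 ≤ A k g U Z ℓ) → (∀ k g U Z ℓ, 0 ≤ A' k g U Z ℓ) →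
      (∀ k g U Z ℓ, A k g U Z ℓ ≤ A' k g U Z ℓ * Real.exp (-(κ * (R.carriers.d Z + 5)))) →
      (∀ k, ∀ g ∈ W, ∀ (U : R.carriers.BgB) (q : SCube R),
        ∑ Z ∈ R.domAt k, ind (q ∈ footprint Z) * actSum (b13InnerData R) (A' k g U) k Z * Real.exp ((footprint Z).card) ≤ Φ') →
      ActOpLineAnalyticOn (labelsIndexing (domainGeometry R) (b13InnerData R)) S.act
        (ballClass (selfCtr (assembly S).raw (assembly S).histRef) ROp RHist) W →
      ActExpLinearOn (labelsIndexing (domainGeometry R) (b13InnerData R)) S.act Dt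
        (ballClass (selfCtr (assembly S).raw (assembly S).histRef) ROp RHist) W →
      NE5 (outA S E₀ cB) (outB S E₀ cB) W κ θ' C₅ := by
  have hG : 0 ≤ Φ' / (1 - 36 * Φ') := div_nonneg hΦ0 (by linarith)
  obtain ⟨ρ₀, hreach, hρ₀, hs⟩ := (reach_elim_iff (mul_nonneg hG hcA) hω1).mpr ⟨hh, hsmall⟩
  obtain ⟨k₀, B, hB, hnear, hfirst⟩ :=
    reach_binders_exists (D := c₁ / r₀ + δ') (add_nonneg (div_nonneg hc₁ hr₀.le) hδ') hθ0 hθ1 hreach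
  refine ⟨(Φ' / (1 - 36 * Φ') / (1 - ρ₀) * (c₁ / r₀) + Φ' / (1 - 36 * Φ') / (1 - ρ₀) * δ' + B) * (θ' - ω) /
    (θ' - (ω + Φ' / (1 - 36 * Φ') / (1 - ρ₀) * cA)), ?_⟩
  intro 𝔾 _ R E IOp Hist Ω _ _ _ S W ROp RHist A A' Dt hSω hT hbB hbA hdA hdB hRA hRB hwer hfl hins hOp hHist hA hA0 hA0' hdec hΦ
    hact hexp
  subst hSω
  exact ne5_of_record_envelope_actNormDecay S E₀ cB hT hbB hbA hdA hdB hRA hRB hwer hfl hins hOp hHist hA hA0 hA0' hκ hdec hΦ0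
    hΦsmall hΦ hact hexp hE₀ one_pos hcA hcB hc₁ hr₀ hδ' hθ0.le hθθ' hθ'1 hω hω1 hρ₀ hnear hB hfirst (smallness_of_gain hs)

end Record

/-! ## §3 R20's re-point: one constant for every pair of runs AND every sub-slot containing the data of record -/

section Restrict

/-- [folklore] **THE η-UNIFORM CAUCHY END FACE OF RECORD RE-POINTED OVER A SUB-SLOT (E9[rec,sub] with `∃ C₅` OUTERMOST).**  Sizes and
size inequalities as in §2.  Then ONE constant `C₅` serves EVERY pair of runs `R`, every slot package of record `S₀` (`S₀.D.ω = ω`), EVERY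
ℂ-submodule `M ≤ OpDatum E` CONTAINING BOTH RUNS' OPERATOR DATA OF RECORD, every window, roomy class, majorants `A`∕`A′` and datum `Dt`
over `↥M`: the displayed binders of `B13StepEnvelopeEndSub.ne5_of_record_restrict_envelope_actNormDecay` — reading, slice budgets, the
quoted levels for `B13StepOfRecord.outA∕outB S₀ E₀ cB`, W1 entry data + floor, W4, room, the activity norm majorant of the cores of
record READ THROUGH THE INCLUSION on the sub-slot ball class with decay split + anchored norm, **`ActOpLineAnalyticOn` over operator
directions IN `M`** (after R20 satisfiable in principle on `measOp`; NOT discharged), `ActExpLinearOn` — IMPLY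
`NE5 (B13StepOfRecord.outA S₀ E₀ cB) (B13StepOfRecord.outB S₀ E₀ cB) W κ θ′ C₅`.  NOT a proof of NE5. -/
theorem uniform_ne5_of_record_restrict_envelope {κ Φ' EA₀ E₀ cA cB c₁ r₀ δ' θ θ' ω : ℝ}
    (hE₀ : 0 ≤ E₀) (hκ : 0 ≤ κ) (hΦ0 : 0 ≤ Φ') (hΦsmall : 36 * Φ' < 1) (hcA : 0 ≤ cA) (hcB : 0 ≤ cB) (hc₁ : 0 ≤ c₁)
    (hr₀ : 0 < r₀) (hδ' : 0 ≤ δ') (hθ0 : 0 < θ) (hθ1 : θ < 1) (hθθ' : θ ≤ θ') (hθ'1 : θ' ≤ 1) (hω : 0 < ω) (hω1 : ω < 1)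
    (hh : cA * (EA₀ + E₀) < 1 - ω) (hsmall : ω + Φ' / (1 - 36 * Φ') * cA * (1 - ω) / (1 - ω - cA * (EA₀ + E₀)) < θ') :
    ∃ C₅ : ℝ, ∀ {𝔾 : Type} [GaugeGroup 𝔾] {R : TwoRuns 𝔾} {E IOp Hist Ω : Type*} [NormedAddCommGroup Hist] [NormedSpace ℂ Hist]
      [MeasurableSpace Ω] (S₀ : Slots R E IOp Hist) (M : Submodule ℂ (OpDatum E))
      (hMA : ∀ g V k, opOf S₀.F S₀.rawA g V k ∈ M) (hMB : ∀ g U k, opOf S₀.F S₀.rawB g U k ∈ M)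
      {W : Set (ℕ → ℝ)} {ROp RHist : ℕ → ℝ}
      {A A' : ℕ → (ℕ → ℝ) → R.carriers.BgB → R.carriers.Dom → InnerLabel R.carriers.Dom (Bnd R) → ℝ}
      {Dt : ActData R.carriers.Dom (InnerLabel R.carriers.Dom (Bnd R)) M Hist Ω},
      S₀.D.ω = ω →
      (assembly S₀).TransportReads W →
      (assembly S₀).SliceBudgetB W κ cB → S₀.D.SliceBudget (step S₀ E₀ cB) W κ cA →
      DecayBound (outA S₀ E₀ cB) W EA₀ κ → DecayBound (outB S₀ E₀ cB) W E₀ κ →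
      RawBounded S₀.F (assembly S₀).rawAt W → RawBounded S₀.F S₀.rawB W →
      WeightedEntrywiseRate S₀.F (assembly S₀).rawAt S₀.rawB W c₁ (fun k => θ ^ k) → (∀ k, r₀ ≤ S₀.rOp k) →
      (step S₀ E₀ cB).InsertionRate W κ E₀ δ' θ →
      (∀ k, S₀.rOp k ≤ ROp k) → (∀ k, (assembly S₀).bHist E₀ cB k + S₀.rHist k ≤ RHist k) →
      (∀ k, ∀ g ∈ W, ∀ (U : R.carriers.BgB) (q : M × Hist),
        q ∈ ballClass (selfCtr (assemblyOn (restrict S₀ M hMA hMB)).raw (assemblyOn (restrict S₀ M hMA hMB)).histRef) ROp RHist k g U →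
          ∀ X : R.carriers.Dom, R.carriers.scale X = k → ∀ i : TermIdx R.carriers.Dom (Bnd R),
            (labelsIndexing (domainGeometry R) (b13InnerData R)).Rel k i X → ∀ m,
              ‖S₀.act ((labelsIndexing (domainGeometry R) (b13InnerData R)).poly i m)
                  ((labelsIndexing (domainGeometry R) (b13InnerData R)).lab i m) (q.1 : OpDatum E) q.2‖ ≤
                A k g U ((labelsIndexing (domainGeometry R) (b13InnerData R)).poly i m)
                  ((labelsIndexing (domainGeometry R) (b13InnerData R)).lab i m)) →
      (∀ k g U Z ℓ, 0 ≤ A k g U Z ℓ) → (∀ k g U Z ℓ, 0 ≤ A' k g U Z ℓ) →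
      (∀ k g U Z ℓ, A k g U Z ℓ ≤ A' k g U Z ℓ * Real.exp (-(κ * (R.carriers.d Z + 5)))) →
      (∀ k, ∀ g ∈ W, ∀ (U : R.carriers.BgB) (q : SCube R),
        ∑ Z ∈ R.domAt k, ind (q ∈ footprint Z) * actSum (b13InnerData R) (A' k g U) k Z * Real.exp ((footprint Z).card) ≤ Φ') →
      ActOpLineAnalyticOn (labelsIndexing (domainGeometry R) (b13InnerData R)) (restrict S₀ M hMA hMB).act
        (ballClass (selfCtr (assemblyOn (restrict S₀ M hMA hMB)).raw (assemblyOn (restrict S₀ M hMA hMB)).histRef) ROp RHist) W →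
      ActExpLinearOn (labelsIndexing (domainGeometry R) (b13InnerData R)) (restrict S₀ M hMA hMB).act Dt
        (ballClass (selfCtr (assemblyOn (restrict S₀ M hMA hMB)).raw (assemblyOn (restrict S₀ M hMA hMB)).histRef) ROp RHist) W →
      NE5 (outA S₀ E₀ cB) (outB S₀ E₀ cB) W κ θ' C₅ := by
  have hG : 0 ≤ Φ' / (1 - 36 * Φ') := div_nonneg hΦ0 (by linarith)
  obtain ⟨ρ₀, hreach, hρ₀, hs⟩ := (reach_elim_iff (mul_nonneg hG hcA) hω1).mpr ⟨hh, hsmall⟩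
  obtain ⟨k₀, B, hB, hnear, hfirst⟩ :=
    reach_binders_exists (D := c₁ / r₀ + δ') (add_nonneg (div_nonneg hc₁ hr₀.le) hδ') hθ0 hθ1 hreach
  refine ⟨(Φ' / (1 - 36 * Φ') / (1 - ρ₀) * (c₁ / r₀) + Φ' / (1 - 36 * Φ') / (1 - ρ₀) * δ' + B) * (θ' - ω) /
    (θ' - (ω + Φ' / (1 - 36 * Φ') / (1 - ρ₀) * cA)), ?_⟩
  intro 𝔾 _ R E IOp Hist Ω _ _ _ S₀ M hMA hMB W ROp RHist A A' Dt hSω hT hbB hbA hdA hdB hRA hRB hwer hfl hins hOp hHist hA hA0 hA0'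
    hdec hΦ hact hexp
  subst hSω
  exact ne5_of_record_restrict_envelope_actNormDecay S₀ M hMA hMB E₀ cB hT hbB hbA hdA hdB hRA hRB hwer hfl hins hOp hHist hA hA0
    hA0' hκ hdec hΦ0 hΦsmall hΦ hact hexp hE₀ one_pos hcA hcB hc₁ hr₀ hδ' hθ0.le hθθ' hθ'1 hω hω1 hρ₀ hnear hB hfirst
    (smallness_of_gain hs)

end Restrict

end Summit.QuantumFields.BalabanUV.T4Continuum.B13StepEnvelopeEndUniform

end
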